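import Summits.CriticalPhenomena.SAWScalingLimit.Theorems.SAWDevelopingMapObservableToSLETypeLadderCarvedReductionSqueezeLimitData
import Summits.CriticalPhenomena.SAWScalingLimit.Theorems.SAWDevelopingMapObservableToSLETypeLadderCarvedReductionSqueezeConnectors
import Summits.CriticalPhenomena.SAWScalingLimit.Theorems.SAWDevelopingMapObservableToSLETypeLadderCarvedReductionSqueezeGateFacts
import HarnessLib

/-!
# Extraction of the limit package with connectors (piece (T-A′₂F package extraction) of stub
# T-A′₂F `stub_carvedReduction_squeezeGeometry_domainsCoreF`)

Crux `SAWDevelopingMap.ObservableToSLE` (stmt-CriticalPhenomena-10472), line `six-class-type-ladder`,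
stub T-A′₂F `stub_carvedReduction_squeezeGeometry_domainsCoreF`.  Landing target:
`Summits/CriticalPhenomena/SAWScalingLimit/Theorems/SAWDevelopingMapObservableToSLETypeLadderCarvedReductionSqueezePkgExtract.lean`.

`squeezePkg_extract`: from the hypotheses of T-A′ (the carved families `hfam`, the realised gates
`hgates`) and the STAGE-1a facts along a subsequence `κ₀`, three successive subsequences —
`squeeze_limitPackage` (bodies from the clean windows of the realised gates), `connector_limits`
for the `S`-side, `connector_limits` for the `T`-side — give `θ` and a `SqueezePkg` along `κ₀ ∘ θ`
(all facts reindexed).  Pure bookkeeping.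
Registered carrier: `stub_carvedReduction_pkgExtract`.
-/

noncomputable section

open scoped Topology
open Filter Set Metric MeasureTheory
open Literature.Probability.LatticeModels (HexVertex hexGraph hexCenter triEmbed Site)
open Literature.Probability.RandomPlanarGeometry
open Literature.Probability.RandomPlanarGeometry.SAW

namespace Summit.CriticalPhenomena.SAWScalingLimit.Theorems.ObservableToSLE.TypeLadder

open Summit.CriticalPhenomena.SAWScalingLimit.Theorems.ObservableToSLER.BridgeGate
open Summit.CriticalPhenomena.SAWScalingLimit.Theorems.ObservableToSLER.NestedGate
open Summit.CriticalPhenomena.SAWScalingLimit.Theorems.ObservableToSLER.TwoPiece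

/-- **EXTRACTION OF THE LIMIT PACKAGE WITH CONNECTORS**; see the module docstring. -/
theorem squeezePkg_extract (D : DobrushinDomain) (a b : ℝ → HexVertex) (hab : IsEmbEndpointApprox hexGraph hexCenter D a b)
    {R ρ : ℝ} {N : ℕ} {δ : ℕ → ℝ} {S T : ℕ → ℕ → Set HexVertex} {n n' : ℕ → ℕ} {q q' : ℕ → HexVertex} (hρ : 0 < ρ)
    (hfam : ∀ k, TameNestedFamily (δ k) R N (a (δ k)) (S k) ∧
      TameNestedFamily (δ k) R N (b (δ k)) (T k) ∧
      (((∀ i, ExteriorAnchored D.carrier (δ k) (S k i) (a (δ k))) ∧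
        (∀ i, ExteriorAnchored D.carrier (δ k) (T k i) (b (δ k))) ∧
        (∀ (i : ℕ) (p q : HexVertex), HasCleanWindow D.carrier (δ k) ρ (S k i) p q →
          rowOf 0 q = rowOf 0 p + 1 ∧
            ∀ x : HexVertex, ((δ k : ℝ) : ℂ) * hexCenter x ∈ ball (((δ k : ℝ) : ℂ) * hexCenter q) ρ →
              (x ∈ S k i ↔ rowOf 0 x ≤ rowOf 0 p)) ∧
        (∀ (i : ℕ) (p q : HexVertex), HasCleanWindow D.carrier (δ k) ρ (T k i) p q →
          rowOf 0 q = rowOf 0 p + 1 ∧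
            ∀ x : HexVertex, ((δ k : ℝ) : ℂ) * hexCenter x ∈ ball (((δ k : ℝ) : ℂ) * hexCenter q) ρ →
              (x ∈ T k i ↔ rowOf 0 x ≤ rowOf 0 p))) ∧
      (∀ (i : ℕ) (p q : HexVertex), HasCleanWindow D.carrier (δ k) ρ (S k i) p q →
        ∃ K : Set ℂ, IsCompact K ∧ IsConnected K ∧
          ((δ k : ℝ) : ℂ) * hexCenter q - ((ρ / 2 : ℝ) : ℂ) * Complex.I ∈ K ∧ ((δ k : ℝ) : ℂ) * hexCenter (a (δ k)) ∈ K ∧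
          ∀ v : HexVertex, Metric.infDist (((δ k : ℝ) : ℂ) * hexCenter v) K ≤ ρ / 4 → v ∈ S k i) ∧
      (∀ (i : ℕ) (p q : HexVertex), HasCleanWindow D.carrier (δ k) ρ (T k i) p q →
        ∃ K : Set ℂ, IsCompact K ∧ IsConnected K ∧
          ((δ k : ℝ) : ℂ) * hexCenter q - ((ρ / 2 : ℝ) : ℂ) * Complex.I ∈ K ∧ ((δ k : ℝ) : ℂ) * hexCenter (b (δ k)) ∈ K ∧
          ∀ v : HexVertex, Metric.infDist (((δ k : ℝ) : ℂ) * hexCenter v) K ≤ ρ / 4 → v ∈ T k i) ∧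
      (∀ i : ℕ, ∃ K : Set ℂ, IsCompact K ∧ IsConnected K ∧ ((δ k : ℝ) : ℂ) * hexCenter (a (δ k)) ∈ K ∧
        (∀ v : HexVertex, Metric.infDist (((δ k : ℝ) : ℂ) * hexCenter v) K ≤ ρ / 8 → v ∈ S k i) ∧
        (∀ v ∈ S k i, ∃ (t w : HexVertex) (r : ℕ), v ∈ hexBall t r ∧ w ∈ hexBall t r ∧
          hexBall t r ⊆ S k i ∧ Metric.infDist (((δ k : ℝ) : ℂ) * hexCenter w) K ≤ ρ / 16)) ∧
      (∀ i : ℕ, ∃ K : Set ℂ, IsCompact K ∧ IsConnected K ∧ ((δ k : ℝ) : ℂ) * hexCenter (b (δ k)) ∈ K ∧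
        (∀ v : HexVertex, Metric.infDist (((δ k : ℝ) : ℂ) * hexCenter v) K ≤ ρ / 8 → v ∈ T k i) ∧
        (∀ v ∈ T k i, ∃ (t w : HexVertex) (r : ℕ), v ∈ hexBall t r ∧ w ∈ hexBall t r ∧
          hexBall t r ⊆ T k i ∧ Metric.infDist (((δ k : ℝ) : ℂ) * hexCenter w) K ≤ ρ / 16))))
    (hgates : ∀ k, ∃ (γ : HexDomainSAW D.carrier (δ k) (a (δ k)) (b (δ k))) (m : ℕ) (p : HexVertex)
        (m' : ℕ) (p' : HexVertex),
      IsFirstGoodGateN D.carrier (δ k) ρ R (S k) (a (δ k)) γ.walk.support (n k) m p (q k) ∧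
      IsFirstGoodGateN D.carrier (δ k) ρ R (T k) (b (δ k)) γ.walk.support.reverse (n' k) m' p' (q' k) ∧
      WideLink D.carrier (δ k) ρ (S k (n k) ∪ T k (n' k)) (q k) (q' k))
    {κ₀ : ℕ → ℕ} {x : ℕ → Site 2} {τ P₀ P₁ : ℂ}
    (hanti : StrictAnti fun j => δ (κ₀ j)) (hspos : ∀ j, 0 < δ (κ₀ j))
    (hs0 : Tendsto (fun j => δ (κ₀ j)) atTop (𝓝[>] 0))
    (hτ : Tendsto (fun j => ((δ (κ₀ j) : ℝ) : ℂ) * triEmbed (x j)) atTop (𝓝 τ))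
    (hconv : Tendsto (fun j => ((δ (κ₀ j) : ℝ) : ℂ) * hexCenter (((q (κ₀ j)).1 - x j, 0) : HexVertex)) atTop (𝓝 P₀))
    (hconv' : Tendsto (fun j => ((δ (κ₀ j) : ℝ) : ℂ) * hexCenter (((q' (κ₀ j)).1 - x j, 0) : HexVertex)) atTop (𝓝 P₁))
    (habove : ∀ j, P₀.im < (((δ (κ₀ j) : ℝ) : ℂ) * hexCenter (((q (κ₀ j)).1 - x j, 0) : HexVertex)).im)
    (habove' : ∀ j, P₁.im < (((δ (κ₀ j) : ℝ) : ℂ) * hexCenter (((q' (κ₀ j)).1 - x j, 0) : HexVertex)).im)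
    (hgate : Tendsto (fun j => ((δ (κ₀ j) : ℝ) : ℂ) * hexCenter (q (κ₀ j))) atTop (𝓝 (P₀ + τ)))
    (hgate' : Tendsto (fun j => ((δ (κ₀ j) : ℝ) : ℂ) * hexCenter (q' (κ₀ j))) atTop (𝓝 (P₁ + τ)))
    (hU : ∀ᶠ j in atTop, ∀ v : HexVertex,
      ((δ (κ₀ j) : ℝ) : ℂ) * hexCenter v - ((δ (κ₀ j) : ℝ) : ℂ) * triEmbed (x j) ∈ ball P₀ (ρ / 2) →
        (v ∈ S (κ₀ j) (n (κ₀ j)) ∪ T (κ₀ j) (n' (κ₀ j)) ↔ v.1 1 < (q (κ₀ j)).1 1))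
    (hU' : ∀ᶠ j in atTop, ∀ v : HexVertex,
      ((δ (κ₀ j) : ℝ) : ℂ) * hexCenter v - ((δ (κ₀ j) : ℝ) : ℂ) * triEmbed (x j) ∈ ball P₁ (ρ / 2) →
        (v ∈ S (κ₀ j) (n (κ₀ j)) ∪ T (κ₀ j) (n' (κ₀ j)) ↔ v.1 1 < (q' (κ₀ j)).1 1))
    (hballs : ∀ᶠ j in atTop, closedBall (P₀ + ((δ (κ₀ j) : ℝ) : ℂ) * triEmbed (x j)) (ρ / 2) ⊆ D.carrier ∧
      closedBall (P₁ + ((δ (κ₀ j) : ℝ) : ℂ) * triEmbed (x j)) (ρ / 2) ⊆ D.carrier)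
    (hqdom : ∀ j, q (κ₀ j) ∈ embMeshDomain hexGraph hexCenter D.carrier (δ (κ₀ j)))
    (hprob : ∀ᶠ j in atTop, IsProbabilityMeasure
      (carvedLaw D.carrier (δ (κ₀ j)) (S (κ₀ j) (n (κ₀ j)) ∪ T (κ₀ j) (n' (κ₀ j))) (q (κ₀ j)) (q' (κ₀ j)))) :
    ∃ θ : ℕ → ℕ, StrictMono θ ∧ Nonempty (SqueezePkg D a b δ S T n n' q q' (κ₀ ∘ θ) ρ R N τ P₀ P₁) := by
  have hs0' : Tendsto (fun j => δ (κ₀ j)) atTop (𝓝 0) := hs0.mono_right nhdsWithin_le_nhds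
  -- the package
  have hfam' : ∀ k, TameNestedFamily (δ k) R N (a (δ k)) (S k) ∧ TameNestedFamily (δ k) R N (b (δ k)) (T k) ∧
      (∀ i : ℕ, ∃ K : Set ℂ, IsCompact K ∧ IsConnected K ∧ ((δ k : ℝ) : ℂ) * hexCenter (a (δ k)) ∈ K ∧
        (∀ v : HexVertex, Metric.infDist (((δ k : ℝ) : ℂ) * hexCenter v) K ≤ ρ / 8 → v ∈ S k i) ∧
        (∀ v ∈ S k i, ∃ (t w : HexVertex) (r : ℕ), v ∈ hexBall t r ∧ w ∈ hexBall t r ∧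
          hexBall t r ⊆ S k i ∧ Metric.infDist (((δ k : ℝ) : ℂ) * hexCenter w) K ≤ ρ / 16)) ∧
      (∀ i : ℕ, ∃ K : Set ℂ, IsCompact K ∧ IsConnected K ∧ ((δ k : ℝ) : ℂ) * hexCenter (b (δ k)) ∈ K ∧
        (∀ v : HexVertex, Metric.infDist (((δ k : ℝ) : ℂ) * hexCenter v) K ≤ ρ / 8 → v ∈ T k i) ∧
        (∀ v ∈ T k i, ∃ (t w : HexVertex) (r : ℕ), v ∈ hexBall t r ∧ w ∈ hexBall t r ∧
          hexBall t r ⊆ T k i ∧ Metric.infDist (((δ k : ℝ) : ℂ) * hexCenter w) K ≤ ρ / 16)) :=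
    fun k => ⟨(hfam k).1, (hfam k).2.1, (hfam k).2.2.2.2.2.1, (hfam k).2.2.2.2.2.2⟩
  have hbody : ∀ k, (∃ K : Set ℂ, IsCompact K ∧ IsConnected K ∧
        ((δ k : ℝ) : ℂ) * hexCenter (q k) - ((ρ / 2 : ℝ) : ℂ) * Complex.I ∈ K ∧ ((δ k : ℝ) : ℂ) * hexCenter (a (δ k)) ∈ K ∧
        ∀ v : HexVertex, Metric.infDist (((δ k : ℝ) : ℂ) * hexCenter v) K ≤ ρ / 4 → v ∈ S k (n k)) ∧
      (∃ K : Set ℂ, IsCompact K ∧ IsConnected K ∧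
        ((δ k : ℝ) : ℂ) * hexCenter (q' k) - ((ρ / 2 : ℝ) : ℂ) * Complex.I ∈ K ∧ ((δ k : ℝ) : ℂ) * hexCenter (b (δ k)) ∈ K ∧
        ∀ v : HexVertex, Metric.infDist (((δ k : ℝ) : ℂ) * hexCenter v) K ≤ ρ / 4 → v ∈ T k (n' k)) := by
    intro k
    obtain ⟨γ, m, p, m', p', hgS, hgT, -⟩ := hgates k
    exact ⟨(hfam k).2.2.2.1 (n k) p (q k) hgS.1.2.2.1, (hfam k).2.2.2.2.1 (n' k) p' (q' k) hgT.1.2.2.1⟩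
  obtain ⟨ψ₁, gS, gT, CS, CT, ϱS, ϱT, KS, KT, BS, BT, KpS, KpT, BpS, BpT, hψ₁, hLS, hLT, hcellS, hcellT, hlimS, hlimT,
      hpers, -, hcarve, hKS, hKT, hKpS, hKpT, hHKS, hHKT, hKper, hBS, hBT, hBpS, hBpT, hHBS, hHBT, hBper⟩ :=
    squeeze_limitPackage D a b hab hρ hfam' hbody (κ := κ₀) hspos hs0 hτ hgate hgate'
  have hψ₁t := hψ₁.tendsto_atTop
  -- the S-side connectors
  set s₁ : ℕ → ℝ := fun j => δ (κ₀ (ψ₁ j)) with hs₁def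
  have hs₁ : ∀ j, 0 < s₁ j := fun j => hspos _
  have hs₁0 : Tendsto s₁ atTop (𝓝 0) := hs0'.comp hψ₁t
  have hs₁w : Tendsto s₁ atTop (𝓝[>] 0) := hs0.comp hψ₁t
  have hτ₁ : Tendsto (fun j => (s₁ j : ℂ) * triEmbed (x (ψ₁ j))) atTop (𝓝 τ) := hτ.comp hψ₁t
  have hrootS : Tendsto (fun j => (s₁ j : ℂ) * hexCenter (a (s₁ j)) - (s₁ j : ℂ) * triEmbed (x (ψ₁ j))) atTop (𝓝 (D.pt 0 - τ)) :=
    tendsto_pinned_root (hab.tendsto_fst.comp hs₁w) hτ₁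
  have hrootT : Tendsto (fun j => (s₁ j : ℂ) * hexCenter (b (s₁ j)) - (s₁ j : ℂ) * triEmbed (x (ψ₁ j))) atTop (𝓝 (D.pt 1 - τ)) :=
    tendsto_pinned_root (hab.tendsto_snd.comp hs₁w) hτ₁
  obtain ⟨ψ₂, CcS, WS, ϱcS, hψ₂, hϱcS0, hCcS, hWS, hWKS, hconnS⟩ := connector_limits (N := N) (s := s₁)
    (τ := fun j => (s₁ j : ℂ) * triEmbed (x (ψ₁ j))) (L := fun j => S (κ₀ (ψ₁ j)) (n (κ₀ (ψ₁ j))))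
    (root := fun j => a (s₁ j)) (g := gS) (Kp := KpS) (Kinf := KS) (C := CS) (R := R) (m := ρ / 16) (ℓ₀ := D.pt 0 - τ)
    hs₁ hs₁0 (fun j => ((hfam (κ₀ (ψ₁ j))).1).2.2.1 _) hrootS (fun j i => (hLS j _).2 ⟨i, mem_hexBall_self _ _⟩)
    (fun i => (hlimS i).1) (fun j => (hKpS j).2.2.2) (fun j => ⟨(hKpS j).1, (hKpS j).2.1.nonempty⟩) hKS.1 ⟨_, hKS.2.2.1⟩ hHKS
  have hψ₂t := hψ₂.tendsto_atTop
  -- the T-side connectors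
  set s₂ : ℕ → ℝ := fun j => s₁ (ψ₂ j) with hs₂def
  obtain ⟨ψ₃, CcT, WT, ϱcT, hψ₃, hϱcT0, hCcT, hWT, hWKT, hconnT⟩ := connector_limits (N := N) (s := s₂)
    (τ := fun j => (s₂ j : ℂ) * triEmbed (x (ψ₁ (ψ₂ j)))) (L := fun j => T (κ₀ (ψ₁ (ψ₂ j))) (n' (κ₀ (ψ₁ (ψ₂ j)))))
    (root := fun j => b (s₂ j)) (g := fun j => gT (ψ₂ j)) (Kp := fun j => KpT (ψ₂ j)) (Kinf := KT) (C := CT) (R := R)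
    (m := ρ / 16) (ℓ₀ := D.pt 1 - τ)
    (fun j => hs₁ _) (hs₁0.comp hψ₂t) (fun j => ((hfam (κ₀ (ψ₁ (ψ₂ j)))).2.1).2.2.1 _) (hrootT.comp hψ₂t)
    (fun j i => (hLT (ψ₂ j) _).2 ⟨i, mem_hexBall_self _ _⟩) (fun i => (hlimT i).1.comp hψ₂t) (fun j => (hKpT (ψ₂ j)).2.2.2)
    (fun j => ⟨(hKpT (ψ₂ j)).1, (hKpT (ψ₂ j)).2.1.nonempty⟩) hKT.1 ⟨_, hKT.2.2.1⟩ (hHKT.comp hψ₂t)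
  have hψ₃t := hψ₃.tendsto_atTop
  -- the final subsequence
  set θ : ℕ → ℕ := fun j => ψ₁ (ψ₂ (ψ₃ j)) with hθdef
  have hθ : StrictMono θ := hψ₁.comp (hψ₂.comp hψ₃)
  have h23 : StrictMono fun j => ψ₂ (ψ₃ j) := hψ₂.comp hψ₃
  have h23t := h23.tendsto_atTop
  have hθt := hθ.tendsto_atTop
  refine ⟨θ, hθ, ⟨{
    x := fun j => x (θ j),
    gS := fun j => gS (ψ₂ (ψ₃ j)),
    gT := fun j => gT (ψ₂ (ψ₃ j)),
    CS := CS,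
    CT := CT,
    ϱS := ϱS,
    ϱT := ϱT,
    KS := KS,
    KT := KT,
    BS := BS,
    BT := BT,
    BpS := fun j => BpS (ψ₂ (ψ₃ j)),
    BpT := fun j => BpT (ψ₂ (ψ₃ j)),
    CcS := CcS,
    CcT := CcT,
    WS := WS,
    WT := WT,
    ϱcS := ϱcS,
    ϱcT := ϱcT,
    spos := fun j => hspos _,
    santi := hanti.comp_strictMono hθ,
    s0 := hs0.comp hθt,
    hτ := hτ.comp hθt,
    hconv := hconv.comp hθt,
    hconv' := hconv'.comp hθt,
    habove := fun j => habove _,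
    habove' := fun j => habove' _,
    hgate := hgate.comp hθt,
    hgate' := hgate'.comp hθt,
    hU := hθt.eventually hU,
    hU' := hθt.eventually hU',
    hballs := hθt.eventually hballs,
    hqdom := fun j => hqdom _,
    hprob := hθt.eventually hprob,
    hSroot := fun j => ((hfam _).1).2.1 _,
    hTroot := fun j => ((hfam _).2.1).2.1 _,
    hSloc := fun j => ((hfam _).1).2.2.1 _,
    hTloc := fun j => ((hfam _).2.1).2.2.1 _,
    hSpre := fun j => ((hfam _).1).2.2.2.1 _,
    hTpre := fun j => ((hfam _).2.1).2.2.2.1 _,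
    hroot0 := hrootS.comp h23t,
    hroot1 := hrootT.comp h23t,
    hLS := fun j v => hLS _ v,
    hLT := fun j v => hLT _ v,
    hϱS0 := fun i => (hcellS i).1,
    hϱT0 := fun i => (hcellT i).1,
    hCS := fun i => (hlimS i).1.comp h23t,
    hradS := fun i => (hlimS i).2.comp h23t,
    hCT := fun i => (hlimT i).1.comp h23t,
    hradT := fun i => (hlimT i).2.comp h23t,
    hpersS := fun ε hε => (h23t.eventually (hpers ε hε)).mono fun j hj i v hv => (hj i v).1 hv,
    hpersT := fun ε hε => (h23t.eventually (hpers ε hε)).mono fun j hj i v hv => (hj i v).2 hv,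
    hcarve := fun K hK h1 h2 => h23t.eventually (hcarve K hK h1 h2),
    hKS := ⟨hKS.1, hKS.2.1, hKS.2.2.1⟩,
    hKT := ⟨hKT.1, hKT.2.1, hKT.2.2.1⟩,
    hKperS := fun ε hε => (h23t.eventually (hKper ε hε)).mono fun j hj v hv => (hj v).1 hv,
    hKperT := fun ε hε => (h23t.eventually (hKper ε hε)).mono fun j hj v hv => (hj v).2 hv,
    hBS := ⟨hBS.1, hBS.2.1, hBS.2.2.1, hBS.2.2.2.1⟩,
    hBT := ⟨hBT.1, hBT.2.1, hBT.2.2.1, hBT.2.2.2.1⟩,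
    hBpS := fun j => hBpS _,
    hBpT := fun j => hBpT _,
    hHS := hHBS.comp h23t,
    hHT := hHBT.comp h23t,
    hbodyper := fun ε hε => h23t.eventually (hBper ε hε),
    hϱcS0 := hϱcS0,
    hϱcT0 := hϱcT0,
    hCcS := hCcS,
    hCcT := hCcT,
    hWS := hWS,
    hWT := hWT,
    hWKS := hWKS,
    hWKT := hWKT,
    hconnS := fun ε hε => hψ₃t.eventually (hconnS ε hε),
    hconnT := hconnT }⟩⟩

/-- **Registered carrier `stub_carvedReduction_pkgExtract`** (crux item stmt-CriticalPhenomena-10472,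
stub T-A′₂F `stub_carvedReduction_squeezeGeometry_domainsCoreF`, piece THE PACKAGE EXTRACTION): a
`SqueezePkg` has positive meshes. -/
theorem stub_carvedReduction_pkgExtract {D : DobrushinDomain} {a b : ℝ → HexVertex} {δ : ℕ → ℝ}
    {S T : ℕ → ℕ → Set HexVertex} {n n' : ℕ → ℕ} {q q' : ℕ → HexVertex} {κ : ℕ → ℕ} {ρ R : ℝ} {N : ℕ} {τ P₀ P₁ : ℂ}
    (Λ : SqueezePkg D a b δ S T n n' q q' κ ρ R N τ P₀ P₁) : ∀ j, 0 < δ (κ j) :=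
  Λ.spos

end Summit.CriticalPhenomena.SAWScalingLimit.Theorems.ObservableToSLE.TypeLadder

end
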